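import Mathlib
import Summits.CriticalPhenomena.PercolationContinuityZ3.Theorems.PercNearOneGluingNoHeavyLowerTailOrientedAntipodalHallOuterOrderedTau

/-!
# SDR form of the oriented antipodal Hall count with petal enlargement and an ordered outer group

Helper file for crux `stmt-CriticalPhenomena-4575` (`NoHeavyLowerTail`, route `PercNearOneGluingNoHeavy`),
new-inequality factory seat `prim-ineq-gen-3` (gen 12).  Everything here is PROVED.

`OrientedAntipodalHall.card_le_card_goods_above_of_outer_ordered_assignment'` counts the CO-GOODS above a bad; here we pass to
the goods (complementation, `card_cogoods_le_card_goods`) and, since the hypotheses are inherited by sub-families, apply Hall's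
marriage theorem: the bads admit DISTINCT good representatives above them
(`exists_injective_good_above_of_outer_ordered_assignment`).  (prim-ineq-gen-3 gen 12, 2026-08-20.)
-/

namespace Summit.CriticalPhenomena.PercolationContinuityZ3.Theorems

namespace OrientedAntipodalHall

open Finset AntipodalStrongHarris AntipodalStrongHarris.Lab ThreeFamilyRank
open scoped FinsetFamily

variable {α : Type*} [DecidableEq α] {k : ℕ}

/-- Complementation maps the co-goods above a bad (`f F = B`, `f (S \ F) = A`, `F` disjoint from a bad) injectively into
the goods above a bad. -/
theorem card_cogoods_le_card_goods (S : Finset α) (f : Finset α → Lab k) (D : Finset (Finset α)) :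
    #{F ∈ S.powerset | f F = bot ∧ f (S \ F) = top ∧ ∃ X ∈ D, X ⊆ S \ F} ≤
      #{U ∈ S.powerset | f U = top ∧ f (S \ U) = bot ∧ ∃ X ∈ D, X ⊆ U} := by
  set K : Finset (Finset α) := {F ∈ S.powerset | f F = bot ∧ f (S \ F) = top ∧ ∃ X ∈ D, X ⊆ S \ F} with hK
  have hKS : ∀ F ∈ K, F ⊆ S := fun F hF => by rw [hK, mem_filter, mem_powerset] at hF; exact hF.1
  have hinj : Set.InjOn (fun F => S \ F) (K : Set (Finset α)) := fun F₁ hF₁ F₂ hF₂ h => by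
    rw [← Finset.sdiff_sdiff_eq_self (hKS F₁ hF₁), ← Finset.sdiff_sdiff_eq_self (hKS F₂ hF₂)]
    simp only at h; rw [h]
  have himg : K.image (fun F => S \ F) ⊆ {U ∈ S.powerset | f U = top ∧ f (S \ U) = bot ∧ ∃ X ∈ D, X ⊆ U} := by
    intro U hU
    obtain ⟨F, hF, rfl⟩ := mem_image.mp hU
    rw [hK, mem_filter, mem_powerset] at hF
    obtain ⟨hFS, hbot, htop, X, hX, hXF⟩ := hF
    rw [mem_filter, mem_powerset]
    refine ⟨sdiff_subset, htop, ?_, X, hX, hXF⟩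
    rw [Finset.sdiff_sdiff_eq_self hFS]; exact hbot
  exact (card_image_of_injOn hinj).symm.le.trans (card_le_card himg)

/-- **Count and SDR form.**  Under the hypotheses of `card_le_card_goods_above_of_outer_ordered_assignment'` the number of goods
above a bad is at least `#D₁ + #D₂ + #D₃`, and the bads admit DISTINCT good representatives above them. -/
theorem exists_injective_good_above_of_outer_ordered_assignment (S : Finset α) {f : Finset α → Lab k}
    (hf : ∀ ⦃X Y : Finset α⦄, X ⊆ Y → f X ≤ f Y) (D₁ D₂ D₃ : Finset (Finset α))
    (cpl : Finset α → Bool) (a b : Finset α → Fin k) (τ : Fin k)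
    (hlab : ∀ X ∈ D₁ ∪ D₂ ∪ D₃, X ⊆ S ∧ (cpl X = false → f X = petal (a X) ∧ f (S \ X) = petal (b X)) ∧
      (cpl X = true → f (S \ X) = petal (a X) ∧ f X = petal (b X)))
    (hτ : ∀ X ∈ D₁ ∪ D₂ ∪ D₃, a X ≠ τ)
    (hE₁ : ∀ X ∈ D₁, cpl X = true) (hE₃ : ∀ Z ∈ D₃, cpl Z = true)
    (hW₁ : ∀ X ∈ D₁, ∀ X' ∈ D₁, a X ≠ b X' ∧ b X ≠ a X')
    (hW₂ : ∀ X ∈ D₂, ∀ X' ∈ D₂, a X ≠ b X' ∧ b X ≠ a X' ∧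
      (cpl X = true → cpl X' = false → ¬ (a X = a X' ∧ b X = b X')))
    (hW₃ : ∀ X ∈ D₃, ∀ X' ∈ D₃, a X ≠ b X' ∧ b X ≠ a X')
    (hC₁₂ : ∀ X ∈ D₁, ∀ Y ∈ D₂, a X ≠ a Y ∧ (b X ≠ b Y ∨ b X = τ) ∧ ¬ (a X = b Y ∧ a Y = b X))
    (hC₂₃ : ∀ Y ∈ D₂, ∀ Z ∈ D₃, a Y ≠ a Z ∧ (b Y ≠ b Z ∨ b Y = τ) ∧ ¬ (a Y = b Z ∧ a Z = b Y))
    (hC₃₁ : ∀ Z ∈ D₃, ∀ X ∈ D₁, a Z ≠ a X ∧ (b Z ≠ b X ∨ b Z = τ) ∧ ¬ (a Z = b X ∧ a X = b Z))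
    (hDD₁ : ∀ X ∈ D₁, ∀ Y ∈ D₂, ∀ Z ∈ D₃, b X = τ → ¬ (a X = b Y ∧ b Y = b Z))
    (hDD₃ : ∀ X ∈ D₁, ∀ Y ∈ D₂, ∀ Z ∈ D₃, ¬ (a Z = b X ∧ b X = b Y) ∧ ¬ (b Z = a X ∧ a X = a Y))
    (hτ₃ : ∀ Y ∈ D₂, ∀ Z ∈ D₃, b Z ≠ a Y) :
    #D₁ + #D₂ + #D₃ ≤ #{U ∈ S.powerset | f U = top ∧ f (S \ U) = bot ∧ ∃ X ∈ D₁ ∪ D₂ ∪ D₃, X ⊆ U} ∧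
    ∃ φ : ↥(D₁ ∪ D₂ ∪ D₃) → Finset α, Function.Injective φ ∧
      ∀ X : ↥(D₁ ∪ D₂ ∪ D₃), (X : Finset α) ⊆ φ X ∧ φ X ⊆ S ∧ f (φ X) = top ∧ f (S \ φ X) = bot := by
  classical
  -- the count for every triple of sub-families
  have hsub : ∀ E₁ E₂ E₃ : Finset (Finset α), E₁ ⊆ D₁ → E₂ ⊆ D₂ → E₃ ⊆ D₃ →
      #E₁ + #E₂ + #E₃ ≤ #{U ∈ S.powerset | f U = top ∧ f (S \ U) = bot ∧ ∃ X ∈ E₁ ∪ E₂ ∪ E₃, X ⊆ U} := by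
    intro E₁ E₂ E₃ h₁ h₂ h₃
    have hEsub : ∀ X ∈ E₁ ∪ E₂ ∪ E₃, X ∈ D₁ ∪ D₂ ∪ D₃ := fun X hX => by
      rcases mem_union.mp hX with h | h
      · rcases mem_union.mp h with h | h
        exacts [mem_union_left _ (mem_union_left _ (h₁ h)), mem_union_left _ (mem_union_right _ (h₂ h))]
      · exact mem_union_right _ (h₃ h)
    refine (card_le_card_goods_above_of_outer_ordered_assignment' S hf E₁ E₂ E₃ cpl a b τ
      (fun X hX => hlab X (hEsub X hX)) (fun X hX => hτ X (hEsub X hX)) (fun X hX => hE₁ X (h₁ hX))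
      (fun Z hZ => hE₃ Z (h₃ hZ)) (fun X hX X' hX' => hW₁ X (h₁ hX) X' (h₁ hX'))
      (fun X hX X' hX' => hW₂ X (h₂ hX) X' (h₂ hX')) (fun X hX X' hX' => hW₃ X (h₃ hX) X' (h₃ hX'))
      (fun X hX Y hY => hC₁₂ X (h₁ hX) Y (h₂ hY)) (fun Y hY Z hZ => hC₂₃ Y (h₂ hY) Z (h₃ hZ))
      (fun Z hZ X hX => hC₃₁ Z (h₃ hZ) X (h₁ hX))
      (fun X hX Y hY Z hZ => hDD₁ X (h₁ hX) Y (h₂ hY) Z (h₃ hZ))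
      (fun X hX Y hY Z hZ => hDD₃ X (h₁ hX) Y (h₂ hY) Z (h₃ hZ))
      (fun Y hY Z hZ => hτ₃ Y (h₂ hY) Z (h₃ hZ))).trans ?_
    exact card_cogoods_le_card_goods S f (E₁ ∪ E₂ ∪ E₃)
  refine ⟨hsub D₁ D₂ D₃ le_rfl le_rfl le_rfl, ?_⟩
  let t : ↥(D₁ ∪ D₂ ∪ D₃) → Finset (Finset α) := fun X =>
    {U ∈ S.powerset | f U = top ∧ f (S \ U) = bot ∧ (X : Finset α) ⊆ U}
  have hHall : ∀ s : Finset ↥(D₁ ∪ D₂ ∪ D₃), #s ≤ #(s.biUnion t) := by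
    intro s
    set D' : Finset (Finset α) := s.map (Function.Embedding.subtype _) with hD'
    have hD'sub : ∀ X ∈ D', X ∈ D₁ ∪ D₂ ∪ D₃ := by
      intro X hX
      obtain ⟨x, -, rfl⟩ := mem_map.mp hX
      exact x.2
    set E₁ : Finset (Finset α) := D'.filter (· ∈ D₁) with hE₁
    set E₂ : Finset (Finset α) := (D'.filter (· ∉ D₁)).filter (· ∈ D₂) with hE₂
    set E₃ : Finset (Finset α) := (D'.filter (· ∉ D₁)).filter (· ∉ D₂) with hE₃
    have hE₁sub : E₁ ⊆ D₁ := fun X hX => (mem_filter.mp hX).2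
    have hE₂sub : E₂ ⊆ D₂ := fun X hX => (mem_filter.mp hX).2
    have hE₃sub : E₃ ⊆ D₃ := by
      intro X hX
      obtain ⟨hX', hX2⟩ := mem_filter.mp hX
      obtain ⟨hXD', hX1⟩ := mem_filter.mp hX'
      rcases mem_union.mp (hD'sub X hXD') with h | h
      · rcases mem_union.mp h with h | h
        exacts [absurd h hX1, absurd h hX2]
      · exact h
    have hcard : #s = #E₁ + #E₂ + #E₃ := by
      rw [hE₁, hE₂, hE₃, add_assoc, card_filter_add_card_filter_not, card_filter_add_card_filter_not]
      exact (card_map _).symm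
    have hED' : ∀ X ∈ E₁ ∪ E₂ ∪ E₃, X ∈ D' := by
      intro X hX
      rcases mem_union.mp hX with h | h
      · rcases mem_union.mp h with h | h
        exacts [(mem_filter.mp h).1, (mem_filter.mp (mem_filter.mp h).1).1]
      · exact (mem_filter.mp (mem_filter.mp h).1).1
    have hgoods : {U ∈ S.powerset | f U = top ∧ f (S \ U) = bot ∧ ∃ X ∈ E₁ ∪ E₂ ∪ E₃, X ⊆ U} ⊆ s.biUnion t := by
      intro U hU
      rw [mem_filter, mem_powerset] at hU
      obtain ⟨hUS, hUtop, hUbot, X, hX, hXU⟩ := hU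
      obtain ⟨x, hx, rfl⟩ := mem_map.mp (hED' X hX)
      rw [mem_biUnion]
      refine ⟨x, hx, ?_⟩
      simp only [t, mem_filter, mem_powerset]
      exact ⟨hUS, hUtop, hUbot, hXU⟩
    calc #s = #E₁ + #E₂ + #E₃ := hcard
      _ ≤ #{U ∈ S.powerset | f U = top ∧ f (S \ U) = bot ∧ ∃ X ∈ E₁ ∪ E₂ ∪ E₃, X ⊆ U} :=
          hsub E₁ E₂ E₃ hE₁sub hE₂sub hE₃sub
      _ ≤ #(s.biUnion t) := card_le_card hgoods
  obtain ⟨φ, hφinj, hφ⟩ := (all_card_le_biUnion_card_iff_exists_injective t).mp hHall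
  refine ⟨φ, hφinj, fun X => ?_⟩
  have hX := hφ X
  simp only [t, mem_filter, mem_powerset] at hX
  exact ⟨hX.2.2.2, hX.1, hX.2.1, hX.2.2.1⟩

end OrientedAntipodalHall

end Summit.CriticalPhenomena.PercolationContinuityZ3.Theorems
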